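import Summits.SmoothPoincare4.SmoothPoincare4.Theses.CylinderEntropy
import Summits.SmoothPoincare4.SmoothPoincare4.Theorems.CylinderEntropySliceIsolationStubConformalEmbedding
import Summits.SmoothPoincare4.SmoothPoincare4.Theorems.CylinderEntropySliceIsolationStubCertLarge
import Summits.SmoothPoincare4.SmoothPoincare4.Theorems.CylinderEntropySliceIsolationStubCertSmall
import Summits.SmoothPoincare4.SmoothPoincare4.Theorems.CylinderEntropySliceIsolationStubDominationBookkeeping
import Summits.SmoothPoincare4.SmoothPoincare4.Theorems.CylinderEntropySliceIsolationStubCertMidLow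
import Summits.SmoothPoincare4.SmoothPoincare4.Theorems.CylinderEntropySliceIsolationStubCertMidLow2
import Summits.SmoothPoincare4.SmoothPoincare4.Theorems.CylinderEntropySliceIsolationStubCertMidLow3
import Summits.SmoothPoincare4.SmoothPoincare4.Theorems.CylinderEntropySliceIsolationStubCertHigh
import Summits.SmoothPoincare4.SmoothPoincare4.Theorems.CylinderEntropySliceIsolationStubCertHigh2
import Literature.Geometry.Riemannian.LowEntropyHypersurfacesFourProofs
import Literature.Topology.FourManifolds.HomotopyS4CompactProofs
import Literature.Topology.FourManifolds.HomotopyS4SimplyConnected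
import Literature.Topology.FourManifolds.SphereSimplyConnected
import HarnessLib

/-!
# `CylinderEntropy.SliceIsolation` reduced to the mid-scale kernel certificates (line `conformal-kernel-domination`, chain β)

The kernel-checked REDUCTION of the crux `Summit.SmoothPoincare4.SmoothPoincare4.Theses.CylinderEntropy.SliceIsolation`
(stmt-SmoothPoincare4-7632: "a universal `ε > 0`: a homotopy 4-sphere smoothly embedded in `N = S⁴ × ℝ ⊂ ℝ⁶` as an
end-separating cross-section with typed cylinder entropy `< 1 + ε` is diffeomorphic to `S⁴`") to TWO named inputs:

1. `Literature.Geometry.Riemannian.ChodoshMantoulidisSchulze2025_lowEntropy_sphere_four` — named published fact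
   (Chodosh–Mantoulidis–Schulze, Duke 2025, Cor. 1.5 (b), `n = 4`);
2. MID-SCALE KERNEL CERTIFICATES (hypothesis `hmid`, the registered stub `stub_certMid` of the line, stated verbatim): for every
   normalised scale `T ∈ [10⁻², 10]` finitely many on-axis zonal heat kernels `w_j 𝔥(τ_j, s) e^{-(u-σ_j)²/4τ_j}` plus an
   area atom `c`, of total mass `∑ w_j + c ≤ 147/100`, dominate the Jacobian-weighted pulled-back Euclidean kernel
   `(8π²/3)(4πT)⁻² e^{4u} e^{-(e^{2u} - 2eᵘ s + 1)/4T}` for all `u ∈ ℝ`, `s ∈ [-1, 1]` — a finite family of inequalities between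
   explicit real functions on a compact parameter range (found by linear programming, to be certified cell by cell).

Everything else is PROVED in the tree: the certificates for `T ≤ 10⁻⁵` (`stub_certSmall`, one atom), `10⁻⁵ ≤ T ≤ 2·10⁻⁴`
(`stub_certMidLow`, one shifted atom), `2·10⁻⁴ ≤ T ≤ 10⁻³` (`stub_certMidLow2`, two atoms), `10⁻³ ≤ T ≤ 10⁻²` (`stub_certMidLow3`, three atoms), `10 ≤ T ≤ 100` (`stub_certHigh2`, flat + two dipole atoms) , `100 ≤ T ≤ 4·10⁴` (`stub_certHigh`, flat +
one dipole atom, uniform in `√(2/T)`) and `T ≥ 4·10⁴` (`stub_certLarge`, the area atom alone), the measure-theoretic bookkeeping turning certificates at every scale into the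
all-scales domination `λ_E(Φ A) ≤ 1.47 λ_cyl(A)` for bounded measurable `A ⊆ N` (`stub_dominationBookkeeping`, through
`SphericalCylinderConformal.gaussianArea_conformal_le_of_certificate`), `Φ ∘ ι` a smooth embedding (`stub_conformalEmbedding`),
and the instances `CompactSpace / PathConnectedSpace / SimplyConnectedSpace M` from `M ≃ₕ S⁴`. Mechanism: `λ_cyl(range ι) < 1 + ε`
with `ε = 4/(1.47e) - 1 > 0` gives `λ_E(Φ(range ι)) ≤ 1.47 (1 + ε) = 4/e = λ(S² × ℝ²)` and CMS (b) concludes.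

This file asserts no route item unconditionally (the theorem is CONDITIONAL on 1.–2.; the gate records it as such) and
introduces no definition.
-/

noncomputable section

-- the registered namespace `Summit.SmoothPoincare4.SmoothPoincare4.Theorems…` repeats a component
set_option linter.dupNamespace false

open MeasureTheory Set
open scoped Manifold ContDiff ENNReal Topology BigOperators ContinuousMap

namespace Summit.SmoothPoincare4.SmoothPoincare4.Theorems.CylinderEntropySliceIsolation

open Literature.Geometry.Riemannian
open Literature.Geometry.Riemannian.SphericalCylinderEntropy (cylEntropy zonal)

/-- `Λ₄ = 32/(3e²) ≤ 147/100`. [folklore] -/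
theorem reductionCertificates_sphereEntropy_le : 32 / (3 * Real.exp 1 ^ 2) ≤ 147 / 100 := by
  have he1 : (2.7182818283 : ℝ) < Real.exp 1 := Real.exp_one_gt_d9
  have he0 : 0 < Real.exp 1 := Real.exp_pos 1
  rw [div_le_div_iff₀ (by positivity) (by norm_num)]
  nlinarith [mul_pos he0 he0]

/-- Packaging a ONE-atom certificate in the `Fin n`-indexed shape consumed by `stub_dominationBookkeeping` (`n = 1`). [folklore] -/
theorem reductionCertificates_of_one {T σ τ w c : ℝ} (hτ : 0 < τ) (hw : 0 ≤ w) (hc : 0 ≤ c) (hmass : w + c ≤ 147 / 100)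
    (hpt : ∀ u s : ℝ, -1 ≤ s → s ≤ 1 →
      (8 * Real.pi ^ 2 / 3) * ((4 * Real.pi * T) ^ 2)⁻¹ * Real.exp (4 * u) *
          Real.exp (-(Real.exp (2 * u) - 2 * Real.exp u * s + 1) / (4 * T)) ≤
        w * (zonal τ s * Real.exp (-(u - σ) ^ 2 / (4 * τ))) + c) :
    ∃ (n : ℕ) (σ τ w : Fin n → ℝ) (c : ℝ), (∀ j, 0 < τ j) ∧ (∀ j, 0 ≤ w j) ∧ 0 ≤ c ∧ (∑ j, w j) + c ≤ 147 / 100 ∧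
      ∀ u s : ℝ, -1 ≤ s → s ≤ 1 →
        (8 * Real.pi ^ 2 / 3) * ((4 * Real.pi * T) ^ 2)⁻¹ * Real.exp (4 * u) *
            Real.exp (-(Real.exp (2 * u) - 2 * Real.exp u * s + 1) / (4 * T)) ≤
          (∑ j, w j * (zonal (τ j) s * Real.exp (-(u - σ j) ^ 2 / (4 * τ j)))) + c := by
  refine ⟨1, fun _ => σ, fun _ => τ, fun _ => w, c, fun _ => hτ, fun _ => hw, hc, by simpa using hmass, ?_⟩
  intro u s hs1 hs2
  simpa using hpt u s hs1 hs2

/-- **Certificates at every normalised scale** from the five landed regime certificates (`T ≤ 10⁻⁵`, `[10⁻⁵, 2·10⁻⁴]`,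
`[2·10⁻⁴, 10⁻³]`, `[100, 4·10⁴]`, `T ≥ 4·10⁴`) and the mid-scale certificates on `[10⁻², 10]` (hypothesis), packaged in the
`Fin n`-indexed shape consumed by `stub_dominationBookkeeping`. [folklore] -/
theorem reductionCertificates_certAll
    (hmid : ∀ T : ℝ, 1 / 100 ≤ T → T ≤ 10 →
      ∃ (n : ℕ) (σ τ w : Fin n → ℝ) (c : ℝ), (∀ j, 0 < τ j) ∧ (∀ j, 0 ≤ w j) ∧ 0 ≤ c ∧ (∑ j, w j) + c ≤ 147 / 100 ∧
        ∀ u s : ℝ, -1 ≤ s → s ≤ 1 →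
          (8 * Real.pi ^ 2 / 3) * ((4 * Real.pi * T) ^ 2)⁻¹ * Real.exp (4 * u) *
              Real.exp (-(Real.exp (2 * u) - 2 * Real.exp u * s + 1) / (4 * T)) ≤
            (∑ j, w j * (zonal (τ j) s * Real.exp (-(u - σ j) ^ 2 / (4 * τ j)))) + c) :
    ∀ T : ℝ, 0 < T →
      ∃ (n : ℕ) (σ τ w : Fin n → ℝ) (c : ℝ), (∀ j, 0 < τ j) ∧ (∀ j, 0 ≤ w j) ∧ 0 ≤ c ∧ (∑ j, w j) + c ≤ 147 / 100 ∧
        ∀ u s : ℝ, -1 ≤ s → s ≤ 1 →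
          (8 * Real.pi ^ 2 / 3) * ((4 * Real.pi * T) ^ 2)⁻¹ * Real.exp (4 * u) *
              Real.exp (-(Real.exp (2 * u) - 2 * Real.exp u * s + 1) / (4 * T)) ≤
            (∑ j, w j * (zonal (τ j) s * Real.exp (-(u - σ j) ^ 2 / (4 * τ j)))) + c := by
  intro T hT
  rcases le_or_gt T (1 / 100000) with h1 | h1
  · obtain ⟨σ, τ, w, c, hτ, hw, hc, hmass, hpt⟩ := stub_certSmall T hT h1
    exact reductionCertificates_of_one hτ hw hc hmass hpt
  rcases le_or_gt T (1 / 5000) with h2 | h2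
  · obtain ⟨σ, τ, w, c, hτ, hw, hc, hmass, hpt⟩ := stub_certMidLow T h1.le h2
    exact reductionCertificates_of_one hτ hw hc hmass hpt
  rcases le_or_gt T (1 / 1000) with h3 | h3
  · obtain ⟨σ₁, τ₁, w₁, σ₂, τ₂, w₂, c, hτ₁, hτ₂, hw₁, hw₂, hc, hmass, hpt⟩ := stub_certMidLow2 T h2.le h3
    refine ⟨2, ![σ₁, σ₂], ![τ₁, τ₂], ![w₁, w₂], c, ?_, ?_, hc, ?_, ?_⟩
    · intro j; fin_cases j <;> simpa
    · intro j; fin_cases j <;> simpa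
    · simpa [Fin.sum_univ_two, add_assoc] using hmass
    · intro u s hs1 hs2
      simpa [Fin.sum_univ_two, add_assoc] using hpt u s hs1 hs2
  rcases le_or_gt T (1 / 100) with h3b | h3b
  · obtain ⟨σ₁, τ₁, w₁, σ₂, τ₂, w₂, σ₃, τ₃, w₃, c, hτ₁, hτ₂, hτ₃, hw₁, hw₂, hw₃, hc, hmass, hpt⟩ :=
      stub_certMidLow3 T h3.le h3b
    refine ⟨3, ![σ₁, σ₂, σ₃], ![τ₁, τ₂, τ₃], ![w₁, w₂, w₃], c, ?_, ?_, hc, ?_, ?_⟩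
    · intro j; fin_cases j <;> simpa
    · intro j; fin_cases j <;> simpa
    · simpa [Fin.sum_univ_three, add_assoc] using hmass
    · intro u s hs1 hs2
      simpa [Fin.sum_univ_three, add_assoc] using hpt u s hs1 hs2
  rcases le_or_gt T 10 with h4a | h4a
  · exact hmid T h3b.le h4a
  rcases le_or_gt T 100 with h4 | h4
  · obtain ⟨σ₁, τ₁, w₁, σ₂, τ₂, w₂, c, hτ₁, hτ₂, hw₁, hw₂, hc, hmass, hpt⟩ := stub_certHigh2 T h4a.le h4
    refine ⟨2, ![σ₁, σ₂], ![τ₁, τ₂], ![w₁, w₂], c, ?_, ?_, hc, ?_, ?_⟩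
    · intro j; fin_cases j <;> simpa
    · intro j; fin_cases j <;> simpa
    · simpa [Fin.sum_univ_two, add_assoc] using hmass
    · intro u s hs1 hs2
      simpa [Fin.sum_univ_two, add_assoc] using hpt u s hs1 hs2
  rcases le_or_gt T 40000 with h5 | h5
  · obtain ⟨σ, τ, w, c, hτ, hw, hc, hmass, hpt⟩ := stub_certHigh T h4.le h5
    exact reductionCertificates_of_one hτ hw hc hmass hpt
  · refine ⟨0, Fin.elim0, Fin.elim0, Fin.elim0, 147 / 100, fun j => j.elim0, fun j => j.elim0, by norm_num, by simp, ?_⟩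
    intro u s hs1 hs2
    simpa using stub_certLarge T h5.le u s hs1 hs2

/-- **`SliceIsolation` from the CMS fact and the mid-scale kernel certificates** (chain β of line
`conformal-kernel-domination`, reduction of crux stmt-SmoothPoincare4-7632; conditional on its two hypotheses, the second being the
registered stub `stub_certMid`, stated verbatim). [folklore] -/
theorem sliceIsolation_of_certificates
    (hCMS : ChodoshMantoulidisSchulze2025_lowEntropy_sphere_four)
    (hmid : ∀ T : ℝ, 1 / 100 ≤ T → T ≤ 10 →
      ∃ (n : ℕ) (σ τ w : Fin n → ℝ) (c : ℝ), (∀ j, 0 < τ j) ∧ (∀ j, 0 ≤ w j) ∧ 0 ≤ c ∧ (∑ j, w j) + c ≤ 147 / 100 ∧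
        ∀ u s : ℝ, -1 ≤ s → s ≤ 1 →
          (8 * Real.pi ^ 2 / 3) * ((4 * Real.pi * T) ^ 2)⁻¹ * Real.exp (4 * u) *
              Real.exp (-(Real.exp (2 * u) - 2 * Real.exp u * s + 1) / (4 * T)) ≤
            (∑ j, w j * (zonal (τ j) s * Real.exp (-(u - σ j) ^ 2 / (4 * τ j)))) + c) :
    Summit.SmoothPoincare4.SmoothPoincare4.Theses.CylinderEntropy.SliceIsolation := by
  have he0 : 0 < Real.exp 1 := Real.exp_pos 1
  have he2 : Real.exp 1 < 2.7182818286 := Real.exp_one_lt_d9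
  -- all-scales domination with constant `147/100`
  have hdom := stub_dominationBookkeeping (147 / 100) reductionCertificates_sphereEntropy_le
    (reductionCertificates_certAll hmid)
  -- the explicit `ε`
  set ε : ℝ := 4 / (147 / 100 * Real.exp 1) - 1 with hε
  have hεpos : 0 < ε := by
    rw [hε, sub_pos, lt_div_iff₀ (by positivity)]
    nlinarith
  have hCε : (147 / 100 : ℝ) * (1 + ε) = 4 / Real.exp 1 := by
    rw [hε]; field_simp; ring
  refine ⟨ε, hεpos, ?_⟩
  intro M _ _ _ _ _ e ι hι hN hsep hent
  -- instances from `M ≃ₕ S⁴` (PROVED in the tree)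
  haveI : CompactSpace M :=
    Literature.Topology.FourManifolds.compactSpace_of_homotopyEquiv_sphere_four_holds M e
  haveI : PathConnectedSpace M := by
    haveI := Literature.Topology.FourManifolds.pathConnectedSpace_sphere_four
    exact Literature.Topology.FourManifolds.pathConnectedSpace_of_homotopyEquiv e
  have hsc : SimplyConnectedSpace M :=
    Literature.Topology.FourManifolds.simplyConnectedSpace_of_homotopyEquiv_sphere_four
      Literature.Topology.FourManifolds.simplyConnectedSpace_sphere_four_holds M e
  -- the cross-section `A = range ι ⊆ N`: measurable, of bounded height
  have hAN : Set.range ι ⊆ {z : EuclideanSpace ℝ (Fin 6) | ∑ i : Fin 5, z (Fin.castSucc i) ^ 2 = 1} := by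
    rintro _ ⟨x, rfl⟩
    exact hN x
  have hcpt : IsCompact (Set.range ι) := isCompact_range hι.isEmbedding.continuous
  have hAm : MeasurableSet (Set.range ι) := hcpt.isClosed.measurableSet
  have hAb : ∃ B : ℝ, ∀ z ∈ Set.range ι, |z 5| ≤ B := by
    obtain ⟨B, hB⟩ := hcpt.exists_bound_of_continuousOn
      ((EuclideanSpace.proj (5 : Fin 6)).continuous.continuousOn)
    exact ⟨B, fun z hz => by simpa [Real.norm_eq_abs] using hB z hz⟩
  have hent' : cylEntropy (Set.range ι) < ENNReal.ofReal (1 + ε) := hent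
  -- the Euclidean entropy of `Φ(range ι)` is at most `4/e = λ(S² × ℝ²)`
  have hbound : gaussianEntropy 4 ((fun z : EuclideanSpace ℝ (Fin 6) =>
      (WithLp.toLp 2 (fun i : Fin 5 => Real.exp (z 5) * z (Fin.castSucc i)) : EuclideanSpace ℝ (Fin 5))) '' Set.range ι) ≤
      gaussianEntropy 4 (shrinkingCylinder 4 2) := by
    calc gaussianEntropy 4 ((fun z : EuclideanSpace ℝ (Fin 6) =>
      (WithLp.toLp 2 (fun i : Fin 5 => Real.exp (z 5) * z (Fin.castSucc i)) : EuclideanSpace ℝ (Fin 5))) '' Set.range ι)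
        ≤ ENNReal.ofReal (147 / 100) * cylEntropy (Set.range ι) := hdom _ hAN hAm hAb
      _ ≤ ENNReal.ofReal (147 / 100) * ENNReal.ofReal (1 + ε) := by gcongr
      _ = ENNReal.ofReal (4 / Real.exp 1) := by
          rw [← ENNReal.ofReal_mul (by norm_num), hCε]
      _ = gaussianEntropy 4 (shrinkingCylinder 4 2) := gaussianEntropy_shrinkingCylinder_four_two.symm
  -- recognition: `Φ ∘ ι` is a smooth embedding (PROVED stub) and the CMS fact, clause (b)
  have hemb : Manifold.IsSmoothEmbedding (𝓡 4) (𝓡 5) ∞ ((fun z : EuclideanSpace ℝ (Fin 6) =>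
      (WithLp.toLp 2 (fun i : Fin 5 => Real.exp (z 5) * z (Fin.castSucc i)) : EuclideanSpace ℝ (Fin 5))) ∘ ι) :=
    stub_conformalEmbedding M ι hι hN
  refine hCMS.of_le_shrinkingCylinder_two M hsc hemb ?_
  rwa [Set.range_comp]

/-- Registered helper `helper_sliceIsolationReductionCertificates` of crux stmt-SmoothPoincare4-7632 (the reduction above, as the
registered one-line `Prop`: CMS fact → mid-scale certificates → `SliceIsolation`). [folklore] -/
theorem helper_sliceIsolationReductionCertificates :
    Literature.Geometry.Riemannian.ChodoshMantoulidisSchulze2025_lowEntropy_sphere_four →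
    (∀ T : ℝ, 1 / 100 ≤ T → T ≤ 10 →
      ∃ (n : ℕ) (σ τ w : Fin n → ℝ) (c : ℝ), (∀ j, 0 < τ j) ∧ (∀ j, 0 ≤ w j) ∧ 0 ≤ c ∧ (∑ j, w j) + c ≤ 147 / 100 ∧
        ∀ u s : ℝ, -1 ≤ s → s ≤ 1 →
          (8 * Real.pi ^ 2 / 3) * ((4 * Real.pi * T) ^ 2)⁻¹ * Real.exp (4 * u) *
              Real.exp (-(Real.exp (2 * u) - 2 * Real.exp u * s + 1) / (4 * T)) ≤
            (∑ j, w j * (Literature.Geometry.Riemannian.SphericalCylinderEntropy.zonal (τ j) s *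
              Real.exp (-(u - σ j) ^ 2 / (4 * τ j)))) + c) →
    Summit.SmoothPoincare4.SmoothPoincare4.Theses.CylinderEntropy.SliceIsolation :=
  sliceIsolation_of_certificates

end Summit.SmoothPoincare4.SmoothPoincare4.Theorems.CylinderEntropySliceIsolation

end
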